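import Literature.AnabelianGeometry.AbsoluteAnabelian.DiagramsOfCategories

/-!
# Morphisms and equivalences of diagrams of categories, rigidity, nexus
# ([AbsTopIII] §0 "Categories" and Definition 3.5 (v), (vi))

Continuation of `DiagramsOfCategories.lean`: honest definitions, over Mathlib category theory, of
S. Mochizuki, *Topics in absolute anabelian geometry III*, §0 p.27 (rigid functors, id-rigid
categories, nexus of an oriented graph, pre-nexus and post-nexus portions) and Definition 3.5 (v), (vi)
pp.76–77 (1-morphisms and 2-morphisms of diagrams of categories, composition, equivalences,
compatibility with families of homotopies, vertex-rigid / edge-rigid / totally rigid diagrams,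
self-equivalences, totally `□`-rigid diagrams, nexus self-equivalences).  Bib key
`MochizukiAbsTopIII2015`; page locators = kurims manuscript pages (`paper:url-5493eb38cbb7`).

Typing notes.
* A 1-morphism `Φ : 𝒟 → 𝒟'` is typed OVER its morphism of oriented graphs `Φ_Γ⃗` (a Mathlib
  prefunctor `F : V ⥤q V'`): `OneMorphism F D D'`; 2-morphisms are between 1-morphisms over the
  same `F` ("such that `Φ_Γ⃗ = Ψ_Γ⃗`").  Composition is over `F ⋙q G`, the identity over `𝟭q V`.
* "Equivalence of diagrams" asks for a quasi-inverse over some `G` with `F ⋙q G = 𝟭q` and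
  `G ⋙q F = 𝟭q` (equalities of graph morphisms, as printed: `Ψ ∘ Φ`, `Φ ∘ Ψ` are 2-isomorphic to
  the identity 1-morphisms, which live over the identity graph morphism); the comparison of a
  1-morphism over `F ⋙q G` with one over `𝟭q` is made after transport along that equality.
* `Aut(𝒟)` (isomorphism classes of self-equivalences, "natural" for vertex-rigid `𝒟`) is typed
  as a quotient TYPE; its group law is not needed by the statements of §3 and is not built here.

Deliberately NOT here: Remark 3.5.1 (discussion), Corollaries 3.6/3.7 (next files).
-/

namespace Literature.AnabelianGeometry.AbsoluteAnabelian

open _root_.CategoryTheory _root_.Quiver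

universe v u w w'

/-! ### §0 "Categories": rigid functors, id-rigid categories -/

/-- A functor `φ : C ⥤ C'` is **rigid** "if every automorphism of `φ` is equal to the identity".
[cite: MochizukiAbsTopIII2015, Section 0 p.27] -/
def IsRigidFunctor {C : Type u} [Category.{v} C] {C' : Type u} [Category.{v} C'] (φ : C ⥤ C') :
    Prop :=
  ∀ α : φ ≅ φ, α = Iso.refl φ

/-- A category `C` is **id-rigid** if its identity functor is rigid.
[cite: MochizukiAbsTopIII2015, Section 0 p.27] -/
def IsIdRigid (C : Type u) [Category.{v} C] : Prop := IsRigidFunctor (𝟭 C)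

namespace DiagramOfCategories

variable {V : Type w} [Quiver.{v} V] {V' : Type w} [Quiver.{v} V'] {V'' : Type w} [Quiver.{v} V'']

/-! ### Definition 3.5 (v): 1-morphisms, 2-morphisms, equivalences -/

/-- **Def 3.5 (v): a 1-morphism of diagrams of categories** `Φ : 𝒟 → 𝒟'` over the morphism of
oriented graphs `Φ_Γ⃗ = F`: (b) for each vertex `v` a functor `Φ_v : 𝒟_v ⥤ 𝒟'_{F v}`, (c) for each
edge `e : v₁ ⟶ v₂` an isomorphism of functors `Φ_e : 𝒟'_{F e} ∘ Φ_{v₁} ⥲ Φ_{v₂} ∘ 𝒟_e`.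
[cite: MochizukiAbsTopIII2015, Definition 3.5 (v) p.76] -/
structure OneMorphism (F : V ⥤q V') (D : DiagramOfCategories.{v, u, w} V)
    (D' : DiagramOfCategories.{v, u, w} V') : Type (max w (v+1) (u+1)) where
  /-- `Φ_v`. -/
  app : ∀ a : V, D.obj a ⥤ D'.obj (F.obj a)
  /-- `Φ_e`. -/
  iso : ∀ {a b : V} (e : a ⟶ b), app a ⋙ D'.map (F.map e) ≅ D.map e ⋙ app b

/-- **Def 3.5 (v): a 2-morphism** `Θ : Φ → Ψ` between 1-morphisms with the same underlying
morphism of graphs: natural transformations `Θ_v : Φ_v ⟶ Ψ_v` with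
`Ψ_e ∘ (𝒟'_{Φ_Γ⃗(e)} ∘ Θ_{v₁}) = (Θ_{v₂} ∘ 𝒟_e) ∘ Φ_e` for every edge `e : v₁ ⟶ v₂`.
[cite: MochizukiAbsTopIII2015, Definition 3.5 (v) p.76] -/
structure TwoMorphism {F : V ⥤q V'} {D : DiagramOfCategories.{v, u, w} V}
    {D' : DiagramOfCategories.{v, u, w} V'} (Φ Ψ : OneMorphism F D D') : Type (max w u v) where
  /-- `Θ_v`. -/
  app : ∀ a : V, Φ.app a ⟶ Ψ.app a
  naturality : ∀ {a b : V} (e : a ⟶ b),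
    Functor.whiskerRight (app a) (D'.map (F.map e)) ≫ (Ψ.iso e).hom =
      (Φ.iso e).hom ≫ Functor.whiskerLeft (D.map e) (app b)

/-- A 2-morphism is a **2-isomorphism** when every `Θ_v` is an isomorphism.
[cite: MochizukiAbsTopIII2015, Definition 3.5 (v) p.76] -/
def TwoMorphism.IsIso {F : V ⥤q V'} {D : DiagramOfCategories.{v, u, w} V}
    {D' : DiagramOfCategories.{v, u, w} V'} {Φ Ψ : OneMorphism F D D'} (Θ : TwoMorphism Φ Ψ) :
    Prop :=
  ∀ a : V, CategoryTheory.IsIso (Θ.app a)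

/-- Two 1-morphisms (over the same graph morphism) are **[2-]isomorphic**.
[cite: MochizukiAbsTopIII2015, Definition 3.5 (v) p.76] -/
def OneMorphism.Isomorphic {F : V ⥤q V'} {D : DiagramOfCategories.{v, u, w} V}
    {D' : DiagramOfCategories.{v, u, w} V'} (Φ Ψ : OneMorphism F D D') : Prop :=
  ∃ Θ : TwoMorphism Φ Ψ, Θ.IsIso

/-- The **identity 1-morphism** of `𝒟` (over the identity morphism of graphs).
[cite: MochizukiAbsTopIII2015, Definition 3.5 (v) p.76] -/
def OneMorphism.id (D : DiagramOfCategories.{v, u, w} V) : OneMorphism (𝟭q V) D D where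
  app a := 𝟭 (D.obj a)
  iso e := (D.map e).leftUnitor ≪≫ (D.map e).rightUnitor.symm

/-- **Composition of 1-morphisms** `Ψ ∘ Φ` (over the composite morphism of graphs).
[cite: MochizukiAbsTopIII2015, Definition 3.5 (v) p.76] -/
def OneMorphism.comp {F : V ⥤q V'} {G : V' ⥤q V''} {D : DiagramOfCategories.{v, u, w} V}
    {D' : DiagramOfCategories.{v, u, w} V'} {D'' : DiagramOfCategories.{v, u, w} V''}
    (Φ : OneMorphism F D D') (Ψ : OneMorphism G D' D'') : OneMorphism (F ⋙q G) D D'' where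
  app a := Φ.app a ⋙ Ψ.app (F.obj a)
  iso {a b} e :=
    Functor.associator _ _ _ ≪≫ Functor.isoWhiskerLeft (Φ.app a) (Ψ.iso (F.map e)) ≪≫
      (Functor.associator _ _ _).symm ≪≫ Functor.isoWhiskerRight (Φ.iso e) (Ψ.app (F.obj b)) ≪≫
      Functor.associator _ _ _

/-- **Def 3.5 (v): equivalence of diagrams of categories.**  `Φ : 𝒟 → 𝒟'` (over `F`) is an
equivalence "if there exists a 1-morphism `Ψ : 𝒟' → 𝒟` such that `Ψ ∘ Φ`, `Φ ∘ Ψ` are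
[2-]isomorphic to the respective identity 1-morphisms of `𝒟`, `𝒟'`" — the identity 1-morphisms
living over the identity graph morphisms, `Ψ` lives over a `G` with `F ⋙q G = 𝟭q V` and
`G ⋙q F = 𝟭q V'`, and the composites are compared after transport along these equalities.
[cite: MochizukiAbsTopIII2015, Definition 3.5 (v) p.76] -/
def OneMorphism.IsEquivalence {F : V ⥤q V'} {D : DiagramOfCategories.{v, u, w} V}
    {D' : DiagramOfCategories.{v, u, w} V'} (Φ : OneMorphism F D D') : Prop :=
  ∃ (G : V' ⥤q V) (Ψ : OneMorphism G D' D) (h₁ : F ⋙q G = 𝟭q V) (h₂ : G ⋙q F = 𝟭q V'),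
    (h₁ ▸ Φ.comp Ψ).Isomorphic (OneMorphism.id D) ∧
      (h₂ ▸ Ψ.comp Φ).Isomorphic (OneMorphism.id D')

/-- **Def 3.5 (v): compatibility of an equivalence with families of homotopies** `ℋ`, `ℋ'` on
`𝒟`, `𝒟'`: "`Φ_Γ⃗` induces a bijection between the boundary sets of `ℋ`, `ℋ'`, and, moreover, the
natural transformations that constitute `ℋ`, `ℋ'` are compatible [in the evident sense] with the
natural transformations that constitute `Φ`".  Typed: (1) `E_ℋ(p,q) ↔ E_ℋ'(Φ_Γ⃗ p, Φ_Γ⃗ q)` and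
every boundary pair of `ℋ'` between vertices in the image arises this way; (2) for each boundary
pair, the square formed by `ζ_ϖ` whiskered with `Φ_{v₂}`, `ζ'_{Φϖ}` whiskered with `Φ_{v₁}`, and
the composite isomorphisms `Φ_{[γ]} : Φ_{v₁} ⋙ 𝒟'_{Φγ} ≅ 𝒟_γ ⋙ Φ_{v₂}` induced by the `Φ_e`
commutes — the latter isomorphisms are recorded as the datum `pathIso` with its defining
property on edges, to keep the statement first-order.
[cite: MochizukiAbsTopIII2015, Definition 3.5 (v) p.76] -/
structure OneMorphism.CompatibleWith {F : V ⥤q V'} {D : DiagramOfCategories.{v, u, w} V}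
    {D' : DiagramOfCategories.{v, u, w} V'} (Φ : OneMorphism F D D') (H : D.HomotopyFamily)
    (H' : D'.HomotopyFamily) : Type (max w (v+1) (u+1)) where
  /-- `Φ_{[γ]}`: the isomorphism along a path, composed from the `Φ_e`. -/
  pathIso : ∀ {a b : V} (p : Path a b),
    Φ.app a ⋙ D'.pathFunctor (F.mapPath p) ≅ D.pathFunctor p ⋙ Φ.app b
  pathIso_nil : ∀ a : V, pathIso (Path.nil : Path a a) =
    eqToIso (by rw [Prefunctor.mapPath_nil, pathFunctor_nil]) ≪≫
      ((Φ.app a).rightUnitor ≪≫ (Φ.app a).leftUnitor.symm) ≪≫ eqToIso (by rw [pathFunctor_nil])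
  pathIso_cons : ∀ {a b c : V} (p : Path a b) (e : b ⟶ c), pathIso (p.cons e) =
    eqToIso (by rw [Prefunctor.mapPath_cons, pathFunctor_cons]) ≪≫
      ((Functor.associator _ _ _).symm ≪≫
        Functor.isoWhiskerRight (pathIso p) (D'.map (F.map e)) ≪≫ Functor.associator _ _ _ ≪≫
        Functor.isoWhiskerLeft (D.pathFunctor p) (Φ.iso e) ≪≫ (Functor.associator _ _ _).symm) ≪≫
      eqToIso (by rw [pathFunctor_cons])
  boundary_iff : ∀ {a b : V} (p q : Path a b), H.E p q ↔ H'.E (F.mapPath p) (F.mapPath q)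
  boundary_surj : ∀ {a b : V} (p' q' : Path (F.obj a) (F.obj b)), H'.E p' q' →
    ∃ p q : Path a b, F.mapPath p = p' ∧ F.mapPath q = q'
  η_compat : ∀ {a b : V} (p q : Path a b) (h : H.E p q),
    Functor.whiskerLeft (Φ.app a) (H'.η ((boundary_iff p q).mp h)) ≫ (pathIso q).hom =
      (pathIso p).hom ≫ Functor.whiskerRight (H.η h) (Φ.app b)

/-! ### Definition 3.5 (v): rigidity, self-equivalences, `Aut(𝒟)` -/

/-- `𝒟` is **vertex-rigid**: every category `𝒟_v` is id-rigid.
[cite: MochizukiAbsTopIII2015, Definition 3.5 (v) pp.76–77] -/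
def IsVertexRigid (D : DiagramOfCategories.{v, u, w} V) : Prop := ∀ a : V, IsIdRigid (D.obj a)

/-- `𝒟` is **edge-rigid**: every functor `𝒟_e` is rigid.
[cite: MochizukiAbsTopIII2015, Definition 3.5 (v) pp.76–77] -/
def IsEdgeRigid (D : DiagramOfCategories.{v, u, w} V) : Prop :=
  ∀ ⦃a b : V⦄ (e : a ⟶ b), IsRigidFunctor (D.map e)

/-- `𝒟` is **totally rigid**: vertex-rigid and edge-rigid.
[cite: MochizukiAbsTopIII2015, Definition 3.5 (v) p.77] -/
def IsTotallyRigid (D : DiagramOfCategories.{v, u, w} V) : Prop :=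
  D.IsVertexRigid ∧ D.IsEdgeRigid

/-- A **self-equivalence** of `𝒟`: a morphism of graphs `Γ⃗_𝒟 → Γ⃗_𝒟` with a 1-morphism over it
that is an equivalence.
[cite: MochizukiAbsTopIII2015, Definition 3.5 (v) p.77] -/
structure SelfEquivalence (D : DiagramOfCategories.{v, u, w} V) : Type (max w (v+1) (u+1)) where
  /-- `Φ_Γ⃗`. -/
  graphMap : V ⥤q V
  /-- `Φ`. -/
  hom : OneMorphism graphMap D D
  isEquivalence : hom.IsEquivalence

/-- Isomorphism of self-equivalences: same morphism of graphs and 2-isomorphic 1-morphisms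
("the isomorphism classes of self-equivalences of `𝒟`").
[cite: MochizukiAbsTopIII2015, Definition 3.5 (v) p.77] -/
def SelfEquivalence.Isomorphic {D : DiagramOfCategories.{v, u, w} V} (Φ Ψ : D.SelfEquivalence) :
    Prop :=
  ∃ h : Φ.graphMap = Ψ.graphMap, (h ▸ Φ.hom).Isomorphic Ψ.hom

/-- **`Aut(𝒟)`** for a [vertex-rigid] diagram: "the group determined by the isomorphism classes of
self-equivalences of `𝒟`" — typed as the quotient of `SelfEquivalence 𝒟` by the equivalence
relation generated by `Isomorphic` (the group structure is not constructed here).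
[cite: MochizukiAbsTopIII2015, Definition 3.5 (v) p.77] -/
def Aut (D : DiagramOfCategories.{v, u, w} V) : Type (max w (v+1) (u+1)) :=
  Quot (SelfEquivalence.Isomorphic (D := D))

/-! ### §0 / Definition 3.5 (vi): nexus, pre-nexus portion, nexus self-equivalences -/

/-- **§0: a nexus** `□` of `Γ⃗` with pre-nexus vertex set `pre` (`□ ∉ pre`): removing `□` and its
edges leaves the disjoint union of two NONEMPTY graphs `Γ⃗_{<□}` (vertices `pre`) and `Γ⃗_{>□}`
(the other vertices) with no edge between them, and every edge at `□` "either runs from a vertex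
of `Γ⃗_{<□}` to `□` or from `□` to a vertex of `Γ⃗_{>□}`" (in particular no loop at `□`).
[cite: MochizukiAbsTopIII2015, Section 0 p.27] -/
structure IsNexus (nx : V) (pre : Set V) : Prop where
  not_mem : nx ∉ pre
  pre_nonempty : pre.Nonempty
  post_nonempty : ∃ a : V, a ≠ nx ∧ a ∉ pre
  no_edge_across : ∀ a b : V, a ∈ pre → b ∉ pre → b ≠ nx → IsEmpty (a ⟶ b) ∧ IsEmpty (b ⟶ a)
  edge_in : ∀ a : V, Nonempty (a ⟶ nx) → a ∈ pre
  edge_out : ∀ b : V, Nonempty (nx ⟶ b) → b ∉ pre ∧ b ≠ nx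

/-- The full sub-quiver on a set of vertices (used for the pre-nexus and post-nexus portions
`Γ⃗_{≤□}`, `Γ⃗_{≥□}`). [folklore] -/
def SubVertex (P : Set V) : Type w := {a : V // a ∈ P}

/-- Edges of the full sub-quiver are the edges of `Γ⃗` between its vertices. [folklore] -/
instance (P : Set V) : Quiver.{v} (SubVertex P) := ⟨fun a b => (a.1 ⟶ b.1)⟩

/-- The restriction `𝒟|_P` of a diagram of categories to the full sub-quiver on `P` (e.g. the
pre-nexus portion `𝒟_{≤□}` for `P = pre ∪ {□}`).
[cite: MochizukiAbsTopIII2015, Definition 3.5 (vi) p.77] -/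
def restrict (D : DiagramOfCategories.{v, u, w} V) (P : Set V) :
    DiagramOfCategories.{v, u, w} (SubVertex P) where
  obj a := D.obj a.1
  map e := D.map e

/-- **Def 3.5 (vi)**: `𝒟` is **totally `□`-rigid** (for a nexus `□` with pre-nexus set `pre`) if the
pre-nexus portion `𝒟_{≤□}` (full sub-diagram on `pre ∪ {□}`) is totally rigid.
[cite: MochizukiAbsTopIII2015, Definition 3.5 (vi) p.77] -/
def IsTotallyNexusRigid (D : DiagramOfCategories.{v, u, w} V) (nx : V) (pre : Set V) : Prop :=
  IsNexus nx pre ∧ (D.restrict (pre ∪ {nx})).IsTotallyRigid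

/-- **Def 3.5 (vi): nexus self-equivalences.**  A self-equivalence `Φ` of `𝒟` is a nexus
self-equivalence relative to `□` if it is of the form produced by the extension procedure of the
text: it "is the identity on `Γ⃗_{𝒟≥□}`" (fixes every vertex and edge of the post-nexus portion,
including `□`), "associates to each vertex `v ≠ □` of `Γ⃗_{𝒟≥□}` the identity self-equivalence of
`𝒟_v`", induces on `𝒟_□` a functor isomorphic to the identity, and maps the pre-nexus portion to
itself ("preserve `□`", `[Φ_{≤□}] ∈ Aut_□(𝒟_{≤□})`).
[cite: MochizukiAbsTopIII2015, Definition 3.5 (vi) p.77] -/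
structure SelfEquivalence.IsNexusClass {D : DiagramOfCategories.{v, u, w} V}
    (Φ : D.SelfEquivalence) (nx : V) (pre : Set V) : Prop where
  isNexus : IsNexus nx pre
  maps_pre : ∀ a : V, a ∈ pre → Φ.graphMap.obj a ∈ pre
  obj_eq_of_not_mem : ∀ a : V, a ∉ pre → Φ.graphMap.obj a = a
  map_heq_of_not_mem : ∀ ⦃a b : V⦄ (e : a ⟶ b), a ∉ pre → b ∉ pre → HEq (Φ.graphMap.map e) e
  app_heq_id : ∀ a : V, a ∉ pre → a ≠ nx → HEq (Φ.hom.app a) (𝟭 (D.obj a))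
  obj_nexus : Φ.graphMap.obj nx = nx
  app_nexus_iso_id : ∃ G : D.obj nx ⥤ D.obj nx, HEq (Φ.hom.app nx) G ∧ Nonempty (G ≅ 𝟭 (D.obj nx))

end DiagramOfCategories

end Literature.AnabelianGeometry.AbsoluteAnabelian
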